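import Summits.AtomisticToContinuum.FouriersLaw.Theorems.PhononMeanFreePathIncoherentBoundedEnergyDynkin
import Summits.AtomisticToContinuum.FouriersLaw.Theorems.PhononMeanFreePathIncoherentBoundedEnergyStatics
import Summits.AtomisticToContinuum.FouriersLaw.Theorems.PhononMeanFreePathIncoherentBoundedFixedN
import Summits.AtomisticToContinuum.FouriersLaw.Theorems.BondHeatUncertaintySubdiffusiveBondHeatBathBondReductionDynkin
import Mathlib.MeasureTheory.Integral.IntegralEqImproper

/-!
# `PhononMeanFreePath.IncoherentBounded` — the zeroth-moment (energy-balance) sum rule, uniformly in `N`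

Helper file for item `stmt-AtomisticToContinuum-11815` (support `IncoherentBounded`, route `PhononMeanFreePath`,
sub-problem `FouriersLaw`). The item asks for `sup_N |a_N| < ∞`, `a_N = N (γ²/T²) ∫_{t>0} [C_N(t) - 2 r_N(t)²] dt`, for
the `(N+1)`-site pinned anharmonic chain between two Langevin baths at the same temperature `T`
(`μ₀ = gibbsMeasure (N+1) T`, `K_t = transitionKernel (N+1) T T t`, both CONSTRUCTED in Literature;
`r_N(t) = ∫ p₀ (K_t p_N) dμ₀`, `C_N(t) = ∫ p₀² (K_t p_N²) dμ₀ - (∫ p₀² dμ₀)(∫ K_t p_N² dμ₀) = ∫ (p₀² - T) K_t(p_N² - T) dμ₀`).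

Besides the cross (contact-to-contact) kernel `C_N` the chain has the NEAR kinetic kernel
`A_N(t) = ∫ (p₀² - T) K_t(p₀² - T) dμ₀` (the kernel `K` of route `BoundaryEscapeDeficit`). This file proves the exact,
`N`-UNIFORM identity tying the two:

* `sumRule_kinCorr` / `sumRule` — **`γ (∫_{t>0} A_N + ∫_{t>0} C_N) = T²`** for every `N` (all parameters, `n ≥ 1` sites).
  Proof (`kinObs_hamiltonian_pairing_sub`): `S(r) = ∫ (p₀² - T) · K_r H dμ₀` satisfies
  `S(r) - S(0) = ∫₀ʳ ∫ (p₀² - T) · K_s(LH) dμ₀ ds = -γ ∫₀ʳ (A_N + C_N)` (Dynkin for `H`, file `…EnergyDynkin`, paired with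
  `p₀² - T ∈ L²(μ₀)` under the invariant Gibbs measure; `LH = -γ((p₀² - T) + (p_N² - T))`), `S(0) = ∫ (p₀² - T) H dμ₀ = T²`
  (Stein, file `…EnergyStatics`), `S(r) → 0` (exponential mixing at FIXED `N`, CEHR Thm 2.13 (3)), and `A_N, C_N ∈ L¹(0,∞)`
  (`kinCorr_integrableOn`); the identity itself carries no `N`-dependent constant.
* `conductance_eq_escapeDeficit` — hence the Green–Kubo conductance of the item's normalisation is
  `(γ²/T²) ∫_{t>0} C_N = γ (1 - (γ/T²) ∫_{t>0} A_N) = γ E_{N+1}`, the ESCAPE DEFICIT of route `BoundaryEscapeDeficit`: the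
  cross-form Kubo value of `PhononMeanFreePath.BoundaryKubo` (`N(γ²/T²)∫C_N`) and the auto-form value of
  `BoundaryEscapeDeficit.ResponseIdentity` (`(N+1-1) γ E_{N+1}`) coincide at every `N`.
* `seq_eq_oneSite`, `incoherentBounded_iff_oneSite` — **the item in one-site form**:
  `a_N = N · (γ - (γ²/T²)(∫_{t>0} A_N + 2∫_{t>0} r_N²))`, so `IncoherentBounded` says exactly that the near contact
  saturates its own sum rule at rate `O(1/N)` once the coherent (Landauer) channel is subtracted:
  `γ E_{N+1} - 2(γ²/T²)∫₀^∞ r_N² = O(1/N)`. The `N`-uniform bounds in the tree (`∫ r_N² ≤ T²/(2γ)`,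
  `…CoherentLandauer`; `∫ C_N² ≤ T⁴/γ`, `…IncoherentL2`) are one-sided/quadratic; the two-sided `O(1/N)` rate is the open
  conductance upper bound (Fourier's law), cf. barrier `FixedLengthNoConductivityControl`.

No definitions; nothing here closes an item.

## References
* A. Kundu, A. Dhar, O. Narayan, *The Green–Kubo formula for heat conduction in open systems*, J. Stat. Mech. (2009)
  L03001, arXiv:0809.4543, p. 3 (time-integrated energy balance against an equilibrium observable; `J_fp`).
* N. Cuneo, J.-P. Eckmann, M. Hairer, L. Rey-Bellet, EJP 23 (2018) no. 55, Thm 2.13 (3) and §3 (3.2)–(3.4).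
-/

noncomputable section

open MeasureTheory ProbabilityTheory Filter Topology Set
open scoped NNReal ENNReal
open Literature.MathematicalPhysics.KineticTheory.HeatConduction
open Literature.MathematicalPhysics.KineticTheory Literature.Probability.Process OscillatorChain
open Summit.AtomisticToContinuum.FouriersLaw.Theorems.SubdiffusiveBondHeat
open Summit.AtomisticToContinuum.FouriersLaw.Theses.PhononMeanFreePath

namespace Summit.AtomisticToContinuum.FouriersLaw.Theorems.IncoherentBounded

/-! ## 3. The zeroth-moment sum rule `γ (∫₀^∞ A + ∫₀^∞ C) = T²` -/

section SumRule

variable {ω₂ lam β γ : ℝ} (hω : 0 < ω₂) (hl : 0 ≤ lam) (hβ : 0 < β) (hγ : 0 < γ) {n : ℕ} (hn : 0 < n)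
  {T : ℝ} (hT : 0 < T)
include hω hl hβ hγ hn hT

omit hγ hn in
/-- A continuous observable dominated by `C (1 + H)²` is square-integrable under `μ_T` and measurable; the three
observables of the sum rule (`p_i² - T`, `H`, `L H`) are of this kind. [folklore] -/
theorem integrable_sq_kinObs (i : Fin n) :
    Integrable (fun y : PhaseSpace n => (y.2 i ^ 2 - T) ^ 2) ((pinnedChain ω₂ lam β γ).gibbsMeasure n T) := by
  refine pinnedChain_integrable_sq_of_abs_le hω hl hβ.le γ n hT (by fun_prop) (C := T + 2) fun y => ?_
  have hH0 : 0 ≤ (pinnedChain ω₂ lam β γ).hamiltonian n y := pinnedChain_hamiltonian_nonneg hω.le hl hβ.le γ n y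
  have hU0 : ∀ q, 0 ≤ (pinnedChain ω₂ lam β γ).U q := fun q => by
    show 0 ≤ ω₂ * q ^ 2 / 2 + lam * q ^ 4 / 4; positivity
  have hV0 : ∀ r, 0 ≤ (pinnedChain ω₂ lam β γ).V r := fun r => by
    show 0 ≤ r ^ 2 / 2 + β * r ^ 4 / 4; positivity
  have hsite := (pinnedChain ω₂ lam β γ).site_le_hamiltonian hU0 hV0 n y i
  have hp : (y.2 i) ^ 2 ≤ 2 * (pinnedChain ω₂ lam β γ).hamiltonian n y := by linarith [hU0 (y.1 i)]
  set H := (pinnedChain ω₂ lam β γ).hamiltonian n y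
  calc |y.2 i ^ 2 - T| ≤ |y.2 i ^ 2| + |T| := abs_sub _ _
    _ = (y.2 i) ^ 2 + T := by rw [abs_of_nonneg (sq_nonneg _), abs_of_pos hT]
    _ ≤ 2 * H + T := by linarith
    _ ≤ (T + 2) * (1 + H) ^ 2 := by nlinarith [hH0, sq_nonneg H, mul_nonneg hT.le hH0, mul_nonneg hT.le (sq_nonneg H)]

omit hβ hγ hn hT in
/-- `|p_i² - T'| ≤ (2/ϑ + |T'|) e^{ϑH}`-type domination used for the kernels: the kinetic observable is integrable
for every transition kernel `P_u(z, ·)` (CEHR (3.4)). [folklore] -/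
theorem integrable_kinObs_transitionKernel (hβ' : 0 ≤ β) (hγ' : 0 ≤ γ) (hn' : 0 < n) (hT' : 0 < T) (i : Fin n)
    (u : ℝ≥0) (z : PhaseSpace n) :
    Integrable (fun y : PhaseSpace n => y.2 i ^ 2 - T) ((pinnedChain ω₂ lam β γ).transitionKernel n T T u z) := by
  have hϑ0 : (0 : ℝ) < 1 / (4 * T) := by positivity
  have hϑ1 : 1 / (4 * T) < 1 / T := by rw [div_lt_div_iff₀ (by positivity) hT']; nlinarith
  exact integrable_of_abs_le_exp
    (pinnedChain_integrable_exp_mul_hamiltonian_transitionKernel hω hl hT' hβ' hγ' hn' hϑ0 hϑ1 u z)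
    (by fun_prop) (fun y => abs_sq_momentum_sub_le_exp hω hl hβ' hϑ0 hT'.le y i)

/-- **The generator of the energy, propagated**: `P_u(LH)(z) = -γ (P_u(p₀² - T)(z) + P_u(p²_{n-1} - T)(z))`.
[cite: BonettoLebowitzReyBellet2000, §5.2 eq. (25)] -/
theorem integral_generator_hamiltonian_transitionKernel (u : ℝ≥0) (z : PhaseSpace n) :
    ∫ y, (pinnedChain ω₂ lam β γ).generator n T T ((pinnedChain ω₂ lam β γ).hamiltonian n) y
        ∂((pinnedChain ω₂ lam β γ).transitionKernel n T T u z) =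
      -γ * ((∫ y, (y.2 ⟨0, hn⟩ ^ 2 - T) ∂((pinnedChain ω₂ lam β γ).transitionKernel n T T u z)) +
        ∫ y, (y.2 ⟨n - 1, Nat.sub_lt hn one_pos⟩ ^ 2 - T) ∂((pinnedChain ω₂ lam β γ).transitionKernel n T T u z)) := by
  have ha := integrable_kinObs_transitionKernel hω hl hβ.le hγ.le hn hT ⟨0, hn⟩ u z
  have hb := integrable_kinObs_transitionKernel hω hl hβ.le hγ.le hn hT ⟨n - 1, Nat.sub_lt hn one_pos⟩ u z
  have hrw : (fun y => (pinnedChain ω₂ lam β γ).generator n T T ((pinnedChain ω₂ lam β γ).hamiltonian n) y) =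
      fun y : PhaseSpace n => -γ * ((y.2 ⟨0, hn⟩ ^ 2 - T) + (y.2 ⟨n - 1, Nat.sub_lt hn one_pos⟩ ^ 2 - T)) := by
    funext y
    rw [pinnedChain_generator_hamiltonian hn]
    ring
  rw [hrw, integral_const_mul, integral_add ha hb]

/-- **The sum rule in differential (Duhamel) form.** With `θ₀ = p₀² - T`, `θ_{n-1} = p²_{n-1} - T`,
`S(r) = ∫ θ₀ · (P_r H) dμ_T`: for `r ≥ 0`,
`S(r) - T² = -γ ∫₀ʳ (∫ θ₀ · P_s θ₀ dμ_T + ∫ θ₀ · P_s θ_{n-1} dμ_T) ds`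
(Dynkin for `H` paired with `θ₀ ∈ L²(μ_T)` under the invariant Gibbs measure, `LH = -γ(θ₀ + θ_{n-1})`, and the static
value `S(0) = ∫ θ₀ H dμ_T = T²`). [cite: KunduDharNarayan2009, arXiv:0809.4543 p. 3] -/
theorem kinObs_hamiltonian_pairing_sub (r : ℝ) (hr : 0 ≤ r) :
    (∫ z, (z.2 ⟨0, hn⟩ ^ 2 - T) * (∫ y, (pinnedChain ω₂ lam β γ).hamiltonian n y
        ∂((pinnedChain ω₂ lam β γ).transitionKernel n T T r.toNNReal z)) ∂((pinnedChain ω₂ lam β γ).gibbsMeasure n T)) -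
        T ^ 2 =
      -γ * ∫ s in (0 : ℝ)..r,
        ((∫ z, (z.2 ⟨0, hn⟩ ^ 2 - T) * (∫ y, (y.2 ⟨0, hn⟩ ^ 2 - T)
            ∂((pinnedChain ω₂ lam β γ).transitionKernel n T T s.toNNReal z)) ∂((pinnedChain ω₂ lam β γ).gibbsMeasure n T)) +
          ∫ z, (z.2 ⟨0, hn⟩ ^ 2 - T) * (∫ y, (y.2 ⟨n - 1, Nat.sub_lt hn one_pos⟩ ^ 2 - T)
            ∂((pinnedChain ω₂ lam β γ).transitionKernel n T T s.toNNReal z)) ∂((pinnedChain ω₂ lam β γ).gibbsMeasure n T)) := by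
  set P := pinnedChain ω₂ lam β γ with hP
  set μ := P.gibbsMeasure n T with hμ
  haveI : IsProbabilityMeasure μ := pinnedChain_isProbabilityMeasure_gibbsMeasure hω hl hβ.le γ n hT
  set a : Fin n := ⟨0, hn⟩ with ha
  set b : Fin n := ⟨n - 1, Nat.sub_lt hn one_pos⟩ with hb
  set θa : PhaseSpace n → ℝ := fun y => y.2 a ^ 2 - T with hθa
  set θb : PhaseSpace n → ℝ := fun y => y.2 b ^ 2 - T with hθb
  have hθac : Continuous θa := by fun_prop
  have hθbc : Continuous θb := by fun_prop
  have hHc : Continuous (P.hamiltonian n) := pinnedChain_continuous_hamiltonian ω₂ lam β γ n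
  have hLc : Continuous fun y => P.generator n T T (P.hamiltonian n) y := by
    have : (fun y => P.generator n T T (P.hamiltonian n) y) = fun y : PhaseSpace n => -γ * (θa y + θb y) := by
      funext y; rw [pinnedChain_generator_hamiltonian hn]; simp only [hθa, hθb]; ring
    rw [this]; fun_prop
  have hinv : ∀ s : ℝ≥0, μ.bind (P.transitionKernel n T T s) = μ := fun s =>
    pinnedChain_gibbsMeasure_bind_transitionKernel hω hl hβ.le hγ.le hn hT s
  -- square-integrability under `μ_T`
  have hθa2 : Integrable (fun y => θa y ^ 2) μ := integrable_sq_kinObs hω hl hβ hT a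
  have hθb2 : Integrable (fun y => θb y ^ 2) μ := integrable_sq_kinObs hω hl hβ hT b
  have hH0 : ∀ y, 0 ≤ P.hamiltonian n y := fun y => pinnedChain_hamiltonian_nonneg hω.le hl hβ.le γ n y
  have hH2 : Integrable (fun y => P.hamiltonian n y ^ 2) μ :=
    pinnedChain_integrable_sq_of_abs_le hω hl hβ.le γ n hT hHc (C := 1) fun y => by
      rw [abs_of_nonneg (hH0 y)]; nlinarith [hH0 y, sq_nonneg (P.hamiltonian n y)]
  have hL2 : Integrable (fun y => (P.generator n T T (P.hamiltonian n) y) ^ 2) μ :=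
    pinnedChain_integrable_sq_of_abs_le hω hl hβ.le γ n hT hLc (C := γ * (2 * T + 4)) fun y =>
      pinnedChain_abs_generator_hamiltonian_le hω.le hl hβ.le hγ.le hn hT.le y
  -- Dynkin for `H`, paired with `θa`
  have hpair := pinnedChain_integral_mul_act_sub_of_dynkin hω hl hβ.le hγ.le n T T μ hinv hθac.measurable
    hHc.measurable hLc.measurable hθa2 hH2 hL2 (pinnedChain_hamiltonian_dynkin hω hl hβ hγ hn hT) hr
  -- the static value
  have h0 : ∫ y, θa y * P.hamiltonian n y ∂μ = T ^ 2 := integral_kinObs_mul_hamiltonian hω hl hβ.le hT a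
  rw [h0] at hpair
  rw [hpair, ← intervalIntegral.integral_const_mul]
  refine intervalIntegral.integral_congr fun s _ => ?_
  -- pointwise in `s`: `∫ θa · P_s(LH) = -γ (∫ θa · P_s θa + ∫ θa · P_s θb)`
  have hIa := (pinnedChain_integrable_mul_act_of_invariant hω hl hβ.le hγ.le n T T μ s.toNNReal (hinv _)
    hθac.measurable hθac.measurable hθa2 hθa2).1
  have hIb := (pinnedChain_integrable_mul_act_of_invariant hω hl hβ.le hγ.le n T T μ s.toNNReal (hinv _)
    hθac.measurable hθbc.measurable hθa2 hθb2).1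
  rw [← integral_add hIa hIb, ← integral_const_mul]
  refine integral_congr_ae (Eventually.of_forall fun z => ?_)
  simp only
  rw [integral_generator_hamiltonian_transitionKernel hω hl hβ hγ hn hT]
  ring

omit hγ hn in
/-- `∫ (p_i² - T) dμ_T = 0` (equipartition). [folklore] -/
theorem integral_kinObs_gibbsMeasure (i : Fin n) :
    ∫ z, (z.2 i ^ 2 - T) ∂((pinnedChain ω₂ lam β γ).gibbsMeasure n T) = 0 := by
  haveI := pinnedChain_isProbabilityMeasure_gibbsMeasure hω hl hβ.le γ n hT
  have hϑ0 : (0 : ℝ) < 1 / (4 * T) := by positivity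
  have hϑ1 : 1 / (4 * T) < 1 / T := by rw [div_lt_div_iff₀ (by positivity) hT]; nlinarith
  have hi2 : Integrable (fun z : PhaseSpace n => z.2 i ^ 2) ((pinnedChain ω₂ lam β γ).gibbsMeasure n T) :=
    integrable_of_abs_le_exp (pinnedChain_integrable_exp_mul_hamiltonian_gibbsMeasure hω hl hβ.le γ n hT hϑ1)
      (by fun_prop) (fun y => by
        rw [abs_of_nonneg (sq_nonneg _)]
        exact sq_momentum_le_exp (γ := γ) hω hl hβ.le hϑ0 y i)
  rw [integral_sub hi2 (integrable_const T), integral_const, integral_momentum_sq_gibbsMeasure hω hl hβ hT n i]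
  simp [probReal_univ]

/-- **The cross kinetic kernel is integrable on `(0, ∞)` at every size**: `u ↦ ∫ (p_i² - T) · P_u(p_j² - T) dμ_T` is in
`L¹(0, ∞)` (exponential mixing at fixed `n`, CEHR Thm 2.13 (3), and `∫ (p_i² - T) dμ_T = 0`).
[cite: CuneoEckmannHairerReyBellet2018, Thm 2.13 (3)] -/
theorem kinCorr_integrableOn (i j : Fin n) :
    IntegrableOn (fun u : ℝ => ∫ z, (z.2 i ^ 2 - T) * (∫ y, (y.2 j ^ 2 - T)
        ∂((pinnedChain ω₂ lam β γ).transitionKernel n T T u.toNNReal z)) ∂((pinnedChain ω₂ lam β γ).gibbsMeasure n T))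
      (Ioi 0) := by
  have hϑ0 : (0 : ℝ) < 1 / (4 * T) := by positivity
  obtain ⟨C, c, hc, hb⟩ := corr_sub_exp_decay hω hl hβ hγ hn hT
    (f := fun z : PhaseSpace n => z.2 i ^ 2 - T) (g := fun z : PhaseSpace n => z.2 j ^ 2 - T)
    (by fun_prop) (by fun_prop) (fun y => abs_sq_momentum_sub_le_exp hω hl hβ.le hϑ0 hT.le y i)
    (fun y => abs_sq_momentum_sub_le_exp hω hl hβ.le hϑ0 hT.le y j)
  refine Integrable.mono' ((exp_neg_integrableOn_Ioi 0 hc).const_mul C)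
    (measurable_corr hω hl hβ hγ hT (f := fun z : PhaseSpace n => z.2 i ^ 2 - T)
      (g := fun z : PhaseSpace n => z.2 j ^ 2 - T) (by fun_prop) (by fun_prop)).aestronglyMeasurable ?_
  refine (ae_restrict_iff' measurableSet_Ioi).2 (Eventually.of_forall fun u hu => ?_)
  have h := hb u.toNNReal
  rw [integral_kinObs_gibbsMeasure hω hl hβ hT i, zero_mul, sub_zero, Real.coe_toNNReal _ (le_of_lt hu)] at h
  rw [Real.norm_eq_abs]
  exact h

/-- **ZEROTH-MOMENT SUM RULE (energy balance of the equilibrium chain in Green–Kubo form).** For the pinned anharmonic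
chain with `n ≥ 1` sites and both Langevin baths at temperature `T > 0` (`ω₂, β, γ > 0`, `lam ≥ 0`), with the
near and far KINETIC KERNELS `K(u) = ∫ (p₀² - T) · P_u(p₀² - T) dμ_T` and `K^far(u) = ∫ (p₀² - T) · P_u(p²_{n-1} - T) dμ_T`
(constructed transition kernels `P_u = transitionKernel n T T u`, Gibbs measure `μ_T`):

  `γ (∫_{(0,∞)} K + ∫_{(0,∞)} K^far) = T² = Var_{μ_T}(p₀²)/2`,

uniformly in `n` (for `n = 1` both baths sit on site `0` and `K^far = K`). Proof: `S(r) = ∫ (p₀² - T) · P_r H dμ_T` has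
`S(r) - T² = -γ ∫₀ʳ (K + K^far)` (`kinObs_hamiltonian_pairing_sub`: Dynkin for `H`, `LH = -γ((p₀² - T) + (p²_{n-1} - T))`,
Stein), `S(r) → 0` by the exponential mixing at fixed `n`, and both kernels are in `L¹(0, ∞)`.
[cite: KunduDharNarayan2009, arXiv:0809.4543 p. 3] -/
theorem sumRule_kinCorr :
    γ * ((∫ u in Ioi (0 : ℝ), ∫ z, (z.2 ⟨0, hn⟩ ^ 2 - T) * (∫ y, (y.2 ⟨0, hn⟩ ^ 2 - T)
          ∂((pinnedChain ω₂ lam β γ).transitionKernel n T T u.toNNReal z)) ∂((pinnedChain ω₂ lam β γ).gibbsMeasure n T)) +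
        ∫ u in Ioi (0 : ℝ), ∫ z, (z.2 ⟨0, hn⟩ ^ 2 - T) * (∫ y, (y.2 ⟨n - 1, Nat.sub_lt hn one_pos⟩ ^ 2 - T)
          ∂((pinnedChain ω₂ lam β γ).transitionKernel n T T u.toNNReal z)) ∂((pinnedChain ω₂ lam β γ).gibbsMeasure n T)) =
      T ^ 2 := by
  set P := pinnedChain ω₂ lam β γ with hP
  set μ := P.gibbsMeasure n T with hμ
  haveI : IsProbabilityMeasure μ := pinnedChain_isProbabilityMeasure_gibbsMeasure hω hl hβ.le γ n hT
  set a : Fin n := ⟨0, hn⟩ with ha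
  set b : Fin n := ⟨n - 1, Nat.sub_lt hn one_pos⟩ with hb
  set 𝒜 : ℝ → ℝ := fun u => ∫ z, (z.2 a ^ 2 - T) * (∫ y, (y.2 a ^ 2 - T) ∂(P.transitionKernel n T T u.toNNReal z)) ∂μ
    with h𝒜
  set 𝒞 : ℝ → ℝ := fun u => ∫ z, (z.2 a ^ 2 - T) * (∫ y, (y.2 b ^ 2 - T) ∂(P.transitionKernel n T T u.toNNReal z)) ∂μ
    with h𝒞
  set S : ℝ → ℝ := fun r => ∫ z, (z.2 a ^ 2 - T) * (∫ y, P.hamiltonian n y ∂(P.transitionKernel n T T r.toNNReal z)) ∂μ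
    with hS
  have hIA : IntegrableOn 𝒜 (Ioi 0) := kinCorr_integrableOn hω hl hβ hγ hn hT a a
  have hIC : IntegrableOn 𝒞 (Ioi 0) := kinCorr_integrableOn hω hl hβ hγ hn hT a b
  -- the interval integrals converge to the improper ones
  have hlim1 : Tendsto (fun r : ℝ => ∫ s in (0:ℝ)..r, (𝒜 s + 𝒞 s)) atTop
      (𝓝 ((∫ u in Ioi (0:ℝ), 𝒜 u) + ∫ u in Ioi (0:ℝ), 𝒞 u)) := by
    rw [← integral_add hIA hIC]
    exact intervalIntegral_tendsto_integral_Ioi 0 (hIA.add hIC) tendsto_id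
  -- `S(r) → 0`
  have hϑ0 : (0 : ℝ) < 1 / (4 * T) := by positivity
  have hHb : ∀ y, |P.hamiltonian n y| ≤ (4 * T) * Real.exp (1 / (4 * T) * P.hamiltonian n y) := fun y => by
    rw [abs_of_nonneg (pinnedChain_hamiltonian_nonneg hω.le hl hβ.le γ n y)]
    have h := hamiltonian_le_exp (ω₂ := ω₂) (lam := lam) (β := β) (γ := γ) (n := n) hϑ0 y
    rw [le_div_iff₀ hϑ0] at h
    have e : 4 * T * Real.exp (1 / (4 * T) * P.hamiltonian n y) =
        Real.exp (1 / (4 * T) * P.hamiltonian n y) * (4 * T) := mul_comm _ _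
    rw [e]
    calc P.hamiltonian n y = P.hamiltonian n y * (1 / (4 * T)) * (4 * T) := by field_simp
      _ ≤ Real.exp (1 / (4 * T) * P.hamiltonian n y) * (4 * T) := mul_le_mul_of_nonneg_right h (by positivity)
  obtain ⟨C, c, hc, hdec⟩ := corr_sub_exp_decay hω hl hβ hγ hn hT
    (f := fun z : PhaseSpace n => z.2 a ^ 2 - T) (g := P.hamiltonian n) (by fun_prop)
    (pinnedChain_continuous_hamiltonian ω₂ lam β γ n) (fun y => abs_sq_momentum_sub_le_exp hω hl hβ.le hϑ0 hT.le y a) hHb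
  have hS0 : Tendsto S atTop (𝓝 0) := by
    have hbound : ∀ᶠ r : ℝ in atTop, ‖S r‖ ≤ C * Real.exp (-c * r) := by
      filter_upwards [eventually_ge_atTop 0] with r hr
      have h := hdec r.toNNReal
      rw [integral_kinObs_gibbsMeasure hω hl hβ hT a, zero_mul, sub_zero, Real.coe_toNNReal _ hr] at h
      rw [Real.norm_eq_abs]
      exact h
    refine squeeze_zero_norm' hbound ?_
    have : Tendsto (fun r : ℝ => -c * r) atTop atBot := tendsto_id.const_mul_atTop_of_neg (by linarith)
    simpa using (Real.tendsto_exp_atBot.comp this).const_mul C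
  -- the Duhamel identity gives the second expression of the same limit
  have hlim2 : Tendsto (fun r : ℝ => ∫ s in (0:ℝ)..r, (𝒜 s + 𝒞 s)) atTop (𝓝 ((T ^ 2 - 0) / γ)) := by
    have hev : (fun r : ℝ => (T ^ 2 - S r) / γ) =ᶠ[atTop] fun r : ℝ => ∫ s in (0:ℝ)..r, (𝒜 s + 𝒞 s) := by
      filter_upwards [eventually_ge_atTop 0] with r hr
      have h := kinObs_hamiltonian_pairing_sub hω hl hβ hγ hn hT r hr
      change S r - T ^ 2 = -γ * ∫ s in (0:ℝ)..r, (𝒜 s + 𝒞 s) at h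
      field_simp
      linarith
    exact ((tendsto_const_nhds.sub hS0).div_const γ).congr' hev
  have heq := tendsto_nhds_unique hlim1 hlim2
  rw [heq]
  field_simp
  ring

end SumRule

/-! ## 4. Consequences for the item: conductance = `γ ×` escape deficit; the one-site form of `a_N` -/

section Item

variable {ω₂ lam β γ : ℝ} (hω : 0 < ω₂) (hl : 0 ≤ lam) (hβ : 0 < β) (hγ : 0 < γ) {T : ℝ} (hT : 0 < T)
include hω hl hβ hγ hT

/-- **The sum rule in the item's normalisation** (`N + 1` sites `0..N`, `A_N(t) = ∫ (p₀² - T) · K_t(p₀² - T) dμ₀` the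
near kinetic kernel, `C_N(t) = ∫ p₀² (K_t p_N²) dμ₀ - (∫ p₀² dμ₀)(∫ K_t p_N² dμ₀)` the item's power covariance):
`∫_{t>0} A_N + ∫_{t>0} C_N = T²/γ` for EVERY `N`. [cite: KunduDharNarayan2009, arXiv:0809.4543 p. 3] -/
theorem sumRule (N : ℕ) :
    (∫ t in Ioi (0 : ℝ), ∫ z, (z.2 0 ^ 2 - T) * (∫ y, (y.2 0 ^ 2 - T)
        ∂((pinnedChain ω₂ lam β γ).transitionKernel (N + 1) T T t.toNNReal z)) ∂((pinnedChain ω₂ lam β γ).gibbsMeasure (N + 1) T)) +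
      ∫ t in Ioi (0 : ℝ), ((∫ z, (z.2 0) ^ 2 * (∫ y, (y.2 (Fin.last N)) ^ 2 ∂((pinnedChain ω₂ lam β γ).transitionKernel (N + 1) T T t.toNNReal z)) ∂((pinnedChain ω₂ lam β γ).gibbsMeasure (N + 1) T)) - (∫ z, (z.2 0) ^ 2 ∂((pinnedChain ω₂ lam β γ).gibbsMeasure (N + 1) T)) * (∫ z, (∫ y, (y.2 (Fin.last N)) ^ 2 ∂((pinnedChain ω₂ lam β γ).transitionKernel (N + 1) T T t.toNNReal z)) ∂((pinnedChain ω₂ lam β γ).gibbsMeasure (N + 1) T))) =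
      T ^ 2 / γ := by
  have hC : (fun t : ℝ => ((∫ z, (z.2 0) ^ 2 * (∫ y, (y.2 (Fin.last N)) ^ 2 ∂((pinnedChain ω₂ lam β γ).transitionKernel (N + 1) T T t.toNNReal z)) ∂((pinnedChain ω₂ lam β γ).gibbsMeasure (N + 1) T)) - (∫ z, (z.2 0) ^ 2 ∂((pinnedChain ω₂ lam β γ).gibbsMeasure (N + 1) T)) * (∫ z, (∫ y, (y.2 (Fin.last N)) ^ 2 ∂((pinnedChain ω₂ lam β γ).transitionKernel (N + 1) T T t.toNNReal z)) ∂((pinnedChain ω₂ lam β γ).gibbsMeasure (N + 1) T)))) =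
      fun t : ℝ => ∫ z, (z.2 0 ^ 2 - T) * (∫ y, (y.2 (Fin.last N) ^ 2 - T)
        ∂((pinnedChain ω₂ lam β γ).transitionKernel (N + 1) T T t.toNNReal z)) ∂((pinnedChain ω₂ lam β γ).gibbsMeasure (N + 1) T) :=
    funext fun t => CN_eq_kinCorr hω hl hβ hγ hT N t
  rw [hC]
  have h := sumRule_kinCorr hω hl hβ hγ (Nat.succ_pos N) hT
  have ha : (⟨0, Nat.succ_pos N⟩ : Fin (N + 1)) = 0 := rfl
  have hb : (⟨N + 1 - 1, Nat.sub_lt (Nat.succ_pos N) one_pos⟩ : Fin (N + 1)) = Fin.last N := rfl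
  rw [ha, hb] at h
  rw [eq_div_iff hγ.ne', mul_comm]
  exact h

/-- **Conductance = `γ ×` escape deficit.** In the item's normalisation the Green–Kubo conductance of the `(N+1)`-site
chain is `(γ²/T²) ∫_{t>0} C_N = γ (1 - (γ/T²) ∫_{t>0} A_N)`: the time-integrated cross (contact-to-contact) kernel is
what the near contact FAILS to re-absorb of its own sum rule `(γ/T²) ∫ (A_N + C_N) = 1` — the escape deficit `E_{N+1}`
of route `BoundaryEscapeDeficit`. [cite: KunduDharNarayan2009, arXiv:0809.4543 p. 3] -/
theorem conductance_eq_escapeDeficit (N : ℕ) :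
    (γ ^ 2 / T ^ 2) * ∫ t in Ioi (0 : ℝ), ((∫ z, (z.2 0) ^ 2 * (∫ y, (y.2 (Fin.last N)) ^ 2 ∂((pinnedChain ω₂ lam β γ).transitionKernel (N + 1) T T t.toNNReal z)) ∂((pinnedChain ω₂ lam β γ).gibbsMeasure (N + 1) T)) - (∫ z, (z.2 0) ^ 2 ∂((pinnedChain ω₂ lam β γ).gibbsMeasure (N + 1) T)) * (∫ z, (∫ y, (y.2 (Fin.last N)) ^ 2 ∂((pinnedChain ω₂ lam β γ).transitionKernel (N + 1) T T t.toNNReal z)) ∂((pinnedChain ω₂ lam β γ).gibbsMeasure (N + 1) T))) =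
      γ * (1 - γ / T ^ 2 * ∫ t in Ioi (0 : ℝ), ∫ z, (z.2 0 ^ 2 - T) * (∫ y, (y.2 0 ^ 2 - T)
        ∂((pinnedChain ω₂ lam β γ).transitionKernel (N + 1) T T t.toNNReal z)) ∂((pinnedChain ω₂ lam β γ).gibbsMeasure (N + 1) T)) := by
  have h := sumRule hω hl hβ hγ hT N
  rw [← eq_sub_iff_add_eq'] at h
  rw [h]
  field_simp

/-- **THE ONE-SITE FORM OF THE ITEM'S SEQUENCE.** For every `N`,
`a_N = N · (γ - (γ²/T²) (∫_{t>0} A_N + 2 ∫_{t>0} r_N²))`: by the sum rule the two-site item `IncoherentBounded`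
(`sup_N |a_N| < ∞`) is the statement that the near contact saturates its own sum rule up to `O(1/N)`,
`(γ²/T²)(∫₀^∞ A_N + 2∫₀^∞ r_N²) = γ - O(1/N)`, i.e. `γ E_{N+1} - 2(γ²/T²)∫₀^∞ r_N² = O(1/N)` (escape deficit minus
coherent channel). [cite: KunduDharNarayan2009, arXiv:0809.4543 p. 3] -/
theorem seq_eq_oneSite (N : ℕ) :
    (N : ℝ) * (γ ^ 2 / T ^ 2) * ∫ t in Set.Ioi (0 : ℝ), (((∫ z, (z.2 0) ^ 2 * (∫ y, (y.2 (Fin.last N)) ^ 2 ∂((pinnedChain ω₂ lam β γ).transitionKernel (N + 1) T T t.toNNReal z)) ∂((pinnedChain ω₂ lam β γ).gibbsMeasure (N + 1) T)) - (∫ z, (z.2 0) ^ 2 ∂((pinnedChain ω₂ lam β γ).gibbsMeasure (N + 1) T)) * (∫ z, (∫ y, (y.2 (Fin.last N)) ^ 2 ∂((pinnedChain ω₂ lam β γ).transitionKernel (N + 1) T T t.toNNReal z)) ∂((pinnedChain ω₂ lam β γ).gibbsMeasure (N + 1) T))) - 2 * (∫ z, z.2 0 * (∫ y, y.2 (Fin.last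 N) ∂((pinnedChain ω₂ lam β γ).transitionKernel (N + 1) T T t.toNNReal z)) ∂((pinnedChain ω₂ lam β γ).gibbsMeasure (N + 1) T)) ^ 2) =
      (N : ℝ) * (γ - (γ ^ 2 / T ^ 2) * ((∫ t in Ioi (0 : ℝ), ∫ z, (z.2 0 ^ 2 - T) * (∫ y, (y.2 0 ^ 2 - T)
        ∂((pinnedChain ω₂ lam β γ).transitionKernel (N + 1) T T t.toNNReal z)) ∂((pinnedChain ω₂ lam β γ).gibbsMeasure (N + 1) T)) +
        2 * ∫ t in Set.Ioi (0 : ℝ), (∫ z, z.2 0 * (∫ y, y.2 (Fin.last N) ∂((pinnedChain ω₂ lam β γ).transitionKernel (N + 1) T T t.toNNReal z)) ∂((pinnedChain ω₂ lam β γ).gibbsMeasure (N + 1) T)) ^ 2)) := by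
  rw [seq_eq_sub hω hl hβ hγ hT N, mul_assoc (N : ℝ) (γ ^ 2 / T ^ 2), conductance_eq_escapeDeficit hω hl hβ hγ hT N]
  field_simp
  ring

end Item

/-- **`IncoherentBounded` in one-site form**: the item is equivalent to
`∀ parameters > 0, ∃ B, ∀ N, |N · (γ - (γ²/T²)(∫_{t>0} A_N + 2∫_{t>0} r_N²))| ≤ B` — an `O(1/N)` saturation rate of the
near-contact sum rule, corrected by the coherent (Landauer) channel. Both `∫ A_N ≥ 0`-type and `∫ r_N² ≤ T²/(2γ)`-type
`N`-uniform bounds are one-sided; the two-sided `O(1/N)` statement is the open conductance bound.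
[cite: KunduDharNarayan2009, arXiv:0809.4543 p. 3] -/
theorem incoherentBounded_iff_oneSite :
    IncoherentBounded ↔ ∀ ω₂ lam β γ : ℝ, 0 < ω₂ → 0 < lam → 0 < β → 0 < γ → ∀ T : ℝ, 0 < T → ∃ B : ℝ, ∀ N : ℕ,
      |(N : ℝ) * (γ - (γ ^ 2 / T ^ 2) * ((∫ t in Ioi (0 : ℝ), ∫ z, (z.2 0 ^ 2 - T) * (∫ y, (y.2 0 ^ 2 - T)
        ∂((pinnedChain ω₂ lam β γ).transitionKernel (N + 1) T T t.toNNReal z)) ∂((pinnedChain ω₂ lam β γ).gibbsMeasure (N + 1) T)) +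
        2 * ∫ t in Set.Ioi (0 : ℝ), (∫ z, z.2 0 * (∫ y, y.2 (Fin.last N) ∂((pinnedChain ω₂ lam β γ).transitionKernel (N + 1) T T t.toNNReal z)) ∂((pinnedChain ω₂ lam β γ).gibbsMeasure (N + 1) T)) ^ 2))| ≤ B := by
  constructor
  · intro h ω₂ lam β γ hω hl hβ hγ T hT
    obtain ⟨B, hB⟩ := h ω₂ lam β γ hω hl hβ hγ T hT
    refine ⟨B, fun N => ?_⟩
    rw [← seq_eq_oneSite hω hl.le hβ hγ hT N]
    exact hB N
  · intro h ω₂ lam β γ hω hl hβ hγ T hT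
    obtain ⟨B, hB⟩ := h ω₂ lam β γ hω hl hβ hγ T hT
    refine ⟨B, fun N => ?_⟩
    rw [seq_eq_oneSite hω hl.le hβ hγ hT N]
    exact hB N



end Summit.AtomisticToContinuum.FouriersLaw.Theorems.IncoherentBounded

end
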